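import Summits.AnomalousDissipation.AnomalousDissipation.Theorems.SolenoidalFractalHomogenisationLagrangianStepCellLawVOddGainDefectPairing
import HarnessLib

/-!
# W5 odd half — the Duhamel defect of a sectorial block against its symmetric part (constants √e and 1) (K1L_D helper)

Lander's extraction (prover ad-k3l-bookkeeping-p1 g4, tenure D24-17 «lander = taker g4 or the worker») of the DEPENDENCY CLOSURE of §8 inside
§6–§7 of planner ad-ideate-p5 g8's `Cruxes/LagrangianRenormalisationStep/OddGainDefectSectorialWindow.lean` v5 (sha ae96de68…): symmetric/skew parts
`symPart`/`skewPart` (+ `symPart_isSymm`, `symPart_add_skewPart`, `form_symPart_quad` — p5's `form_symPart_quad`, RENAMED to avoid the clash with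
`…OddGainDefectPairing.form_symPart_quad` of the (w-c) worker —, `skewPart_mulVec`, `window_symPart_sum`, `skewPart_sq_le`) and the two energy estimates
for the Duhamel defect `w(t) = e^{−tB}v − e^{−tH}v`: **`duhamel_defect_sq_le`** (constant `√e`) and **`duhamel_defect_sq_le_one`** (constant `1`).
p5's `lo_le_hi_of_window` and `lowerEdgeTarget_holds` are NOT repeated (identical statements landed by the worker: `…Pairing`, `…LowerEdge`).
Bodies byte-identical to the source modulo the one rename. No named facts, no sorry.
-/

set_option linter.dupNamespace false
set_option linter.style.longLine false

noncomputable section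

namespace Summit.AnomalousDissipation.AnomalousDissipation.Theorems.SolenoidalFractalHomogenisation.LagrangianStep.OddGain

open Matrix Finset
open Literature.Analysis.FluidPDE.KY (real_dot_eq)

section Duhamel

open Literature.Analysis Literature.Analysis.FunctionSpaces Literature.Analysis.FluidPDE
open Literature.Analysis.FluidPDE.LatticeShear
open Literature.Analysis.ODE.PeriodicAveraging

/-- The symmetric part `H = (B + Bᵀ)/2`. -/
def symPart (B : Matrix (Fin 3) (Fin 3) ℝ) : Matrix (Fin 3) (Fin 3) ℝ := (1 / 2 : ℝ) • (B + Bᵀ)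

/-- The skew part `K = (B − Bᵀ)/2`. -/
def skewPart (B : Matrix (Fin 3) (Fin 3) ℝ) : Matrix (Fin 3) (Fin 3) ℝ := (1 / 2 : ℝ) • (B - Bᵀ)

/-- `symPart_isSymm` (p5 g8, OddGainDefectSectorialWindow §6–7; see the file header). -/
theorem symPart_isSymm (B : Matrix (Fin 3) (Fin 3) ℝ) : (symPart B).IsSymm := by
  unfold symPart Matrix.IsSymm
  rw [Matrix.transpose_smul, Matrix.transpose_add, Matrix.transpose_transpose, add_comm]

/-- `symPart_add_skewPart` (p5 g8, OddGainDefectSectorialWindow §6–7; see the file header). -/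
theorem symPart_add_skewPart (B : Matrix (Fin 3) (Fin 3) ℝ) : symPart B + skewPart B = B := by
  ext i j
  simp only [symPart, skewPart, Matrix.add_apply, Matrix.smul_apply, Matrix.sub_apply, Matrix.transpose_apply,
    smul_eq_mul]
  ring

/-- `xᵀHx = xᵀBx`. -/
theorem form_symPart_quad (B : Matrix (Fin 3) (Fin 3) ℝ) (x : Fin 3 → ℝ) : x ⬝ᵥ (symPart B) *ᵥ x = x ⬝ᵥ B *ᵥ x := by
  unfold symPart
  rw [Matrix.smul_mulVec, dotProduct_smul, Matrix.add_mulVec, dotProduct_add, ← form_comm_transpose B x x,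
    smul_eq_mul]
  ring

/-- `K y = ½ (B y − Bᵀ y)`. -/
theorem skewPart_mulVec (B : Matrix (Fin 3) (Fin 3) ℝ) (y : Fin 3 → ℝ) :
    (skewPart B) *ᵥ y = (1 / 2 : ℝ) • (B *ᵥ y - Bᵀ *ᵥ y) := by
  unfold skewPart
  rw [Matrix.smul_mulVec, Matrix.sub_mulVec]

/-- `ΣΣ`-form of the window of `H` (the shape the Literature semigroup lemmas want). -/
theorem window_symPart_sum {B : Matrix (Fin 3) (Fin 3) ℝ} {lo hi : ℝ}
    (hwin : ∀ x : Fin 3 → ℝ, lo * (x ⬝ᵥ x) ≤ x ⬝ᵥ B *ᵥ x ∧ x ⬝ᵥ B *ᵥ x ≤ hi * (x ⬝ᵥ x)) (x : Fin 3 → ℝ) :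
    lo * ∑ i, x i ^ 2 ≤ ∑ i, ∑ j, x i * symPart B i j * x j ∧ ∑ i, ∑ j, x i * symPart B i j * x j ≤ hi * ∑ i, x i ^ 2 := by
  rw [sum_sum_eq_form, form_symPart_quad, ← self_dotProduct_eq_sum_sq]
  exact hwin x

/-- The skew part is small: `Σ (K y)ᵢ² ≤ (τhi/2)² Σ yᵢ²`. -/
theorem skewPart_sq_le {B : Matrix (Fin 3) (Fin 3) ℝ} {τ lo hi : ℝ} (hlo : 0 ≤ lo)
    (hsec : ∀ x z : Fin 3 → ℝ, (x ⬝ᵥ B *ᵥ z - z ⬝ᵥ B *ᵥ x) ^ 2 ≤ τ ^ 2 * ((x ⬝ᵥ B *ᵥ x) * (z ⬝ᵥ B *ᵥ z)))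
    (hwin : ∀ x : Fin 3 → ℝ, lo * (x ⬝ᵥ x) ≤ x ⬝ᵥ B *ᵥ x ∧ x ⬝ᵥ B *ᵥ x ≤ hi * (x ⬝ᵥ x)) (y : Fin 3 → ℝ) :
    ∑ i, ((skewPart B) *ᵥ y) i ^ 2 ≤ (τ * hi / 2) ^ 2 * ∑ i, y i ^ 2 := by
  have h := skew_sq_le_of_sector hlo hsec hwin y
  rw [self_dotProduct_eq_sum_sq, self_dotProduct_eq_sum_sq] at h
  rw [skewPart_mulVec]
  have h4 : ∑ i, ((1 / 2 : ℝ) • (B *ᵥ y - Bᵀ *ᵥ y)) i ^ 2 = (1 / 4) * ∑ i, (B *ᵥ y - Bᵀ *ᵥ y) i ^ 2 := by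
    rw [Finset.mul_sum]
    refine Finset.sum_congr rfl fun i _ => ?_
    simp only [Pi.smul_apply, smul_eq_mul]
    ring
  rw [h4]
  nlinarith [h]

/-- **The energy estimate for the Duhamel defect** `w(t) = e^{−tB}v − e^{−tH}v` (`H` the symmetric part):
`Σ wᵢ(t)² ≤ e · (τhi/2)² · t² · e^{−2lo t} · Σ vᵢ²` for `t ≥ 0`.  Proof: `|w|²' = −2wᵀBw − 2wᵀK e^{−tH}v ≤ (μ − 2lo)|w|² + (τhi/2)²e^{−2lo t}|v|²/μ`,
so `e^{(2lo−μ)s}|w|² + (τhi/2)²|v|²e^{−μs}/μ²` is non-increasing; `μ = 1/t`. [folklore] -/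
theorem duhamel_defect_sq_le {B : Matrix (Fin 3) (Fin 3) ℝ} {τ lo hi : ℝ} (hlo : 0 ≤ lo)
    (hsec : ∀ x z : Fin 3 → ℝ, (x ⬝ᵥ B *ᵥ z - z ⬝ᵥ B *ᵥ x) ^ 2 ≤ τ ^ 2 * ((x ⬝ᵥ B *ᵥ x) * (z ⬝ᵥ B *ᵥ z)))
    (hwin : ∀ x : Fin 3 → ℝ, lo * (x ⬝ᵥ x) ≤ x ⬝ᵥ B *ᵥ x ∧ x ⬝ᵥ B *ᵥ x ≤ hi * (x ⬝ᵥ x)) (v : Fin 3 → ℝ) {t : ℝ} (ht : 0 ≤ t) :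
    ∑ i, ((NormedSpace.exp (-(t • B))).mulVec v - (NormedSpace.exp (-(t • symPart B))).mulVec v) i ^ 2 ≤
      Real.exp 1 * (τ * hi / 2) ^ 2 * t ^ 2 * Real.exp (-(2 * lo * t)) * ∑ i, v i ^ 2 := by
  set H := symPart B with hH
  set K := skewPart B with hK
  set zB : ℝ → Fin 3 → ℝ := fun s => (NormedSpace.exp (-(s • B))).mulVec v with hzB
  set zH : ℝ → Fin 3 → ℝ := fun s => (NormedSpace.exp (-(s • H))).mulVec v with hzH
  set w : ℝ → Fin 3 → ℝ := fun s => zB s - zH s with hw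
  set V := ∑ i, v i ^ 2 with hV
  set E : ℝ → ℝ := fun s => ∑ i, w s i ^ 2 with hE
  have hV0 : 0 ≤ V := Finset.sum_nonneg fun i _ => sq_nonneg _
  -- the case t = 0
  rcases ht.eq_or_lt with h0 | htpos
  · rw [← h0]
    simp
  -- derivative of w
  have hwd : ∀ s, HasDerivAt w (-(B.mulVec (zB s)) - -(H.mulVec (zH s))) s := fun s =>
    (hasDerivAt_exp_neg_smul_mulVec B v s).sub (hasDerivAt_exp_neg_smul_mulVec H v s)
  -- rewrite the derivative: -B zB + H zH = -(B w) - K zH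
  have hderiv_eq : ∀ s, -(B.mulVec (zB s)) - -(H.mulVec (zH s)) = -(B.mulVec (w s)) - K.mulVec (zH s) := by
    intro s
    have h1 : zB s = w s + zH s := by simp [hw]
    have h2 : K = B - H := eq_sub_of_add_eq' (symPart_add_skewPart B)
    rw [h1, Matrix.mulVec_add, h2, Matrix.sub_mulVec]
    abel
  -- derivative of the energy
  have hEd : ∀ s, HasDerivAt E (∑ i, 2 * w s i * (-(B.mulVec (w s)) - K.mulVec (zH s)) i) s := by
    intro s
    have h := (hwd s)
    rw [hderiv_eq s, hasDerivAt_pi] at h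
    have h2 := HasDerivAt.fun_sum (u := Finset.univ) fun i _ => (h i).fun_pow 2
    refine h2.congr_deriv (Finset.sum_congr rfl fun i _ => ?_)
    simp only [Nat.cast_ofNat, Nat.add_one_sub_one, pow_one]
  -- the differential inequality, for s ≥ 0 and any μ > 0
  have hineq : ∀ μ : ℝ, 0 < μ → ∀ s : ℝ, 0 ≤ s →
      ∑ i, 2 * w s i * (-(B.mulVec (w s)) - K.mulVec (zH s)) i ≤
        (μ - 2 * lo) * E s + (τ * hi / 2) ^ 2 * V * Real.exp (-(2 * lo * s)) / μ := by
    intro μ hμ s hs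
    -- split the sum
    have hsplit : ∑ i, 2 * w s i * (-(B.mulVec (w s)) - K.mulVec (zH s)) i =
        -2 * (w s ⬝ᵥ B *ᵥ w s) + ∑ i, (-2) * (w s i * K.mulVec (zH s) i) := by
      simp only [dotProduct, Pi.sub_apply, Pi.neg_apply, Finset.mul_sum, ← Finset.sum_add_distrib]
      refine Finset.sum_congr rfl fun i _ => ?_
      ring
    rw [hsplit]
    have hBw : lo * E s ≤ w s ⬝ᵥ B *ᵥ w s := by
      have := (hwin (w s)).1
      rw [self_dotProduct_eq_sum_sq] at this
      exact this
    -- termwise AM-GM: -2ab ≤ μ a² + b²/μ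
    have hamgm : ∑ i, (-2) * (w s i * K.mulVec (zH s) i) ≤ μ * E s + (∑ i, K.mulVec (zH s) i ^ 2) / μ := by
      rw [hE]
      simp only
      rw [Finset.mul_sum, Finset.sum_div, ← Finset.sum_add_distrib]
      refine Finset.sum_le_sum fun i _ => ?_
      have hsq : 0 ≤ (μ * w s i + K.mulVec (zH s) i) ^ 2 / μ := div_nonneg (sq_nonneg _) hμ.le
      have hexp : (μ * w s i + K.mulVec (zH s) i) ^ 2 / μ =
          μ * w s i ^ 2 + 2 * (w s i * K.mulVec (zH s) i) + K.mulVec (zH s) i ^ 2 / μ := by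
        field_simp
        ring
      linarith
    have hKz : ∑ i, K.mulVec (zH s) i ^ 2 ≤ (τ * hi / 2) ^ 2 * ∑ i, zH s i ^ 2 := skewPart_sq_le hlo hsec hwin (zH s)
    have hzH : ∑ i, zH s i ^ 2 ≤ Real.exp (-(2 * lo * s)) * V :=
      sum_sq_exp_neg_smul_mulVec_le H (fun x => (window_symPart_sum hwin x).1) v hs
    have hc : (∑ i, K.mulVec (zH s) i ^ 2) / μ ≤ (τ * hi / 2) ^ 2 * V * Real.exp (-(2 * lo * s)) / μ := by
      refine div_le_div_of_nonneg_right ?_ hμ.le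
      calc ∑ i, K.mulVec (zH s) i ^ 2 ≤ (τ * hi / 2) ^ 2 * ∑ i, zH s i ^ 2 := hKz
        _ ≤ (τ * hi / 2) ^ 2 * (Real.exp (-(2 * lo * s)) * V) := mul_le_mul_of_nonneg_left hzH (sq_nonneg _)
        _ = (τ * hi / 2) ^ 2 * V * Real.exp (-(2 * lo * s)) := by ring
    nlinarith
  -- the Lyapunov function Ψ for μ = 1/t
  set μ := 1 / t with hμ
  have hμpos : 0 < μ := by rw [hμ]; positivity
  set D := (τ * hi / 2) ^ 2 * V / μ ^ 2 with hD
  set Ψ : ℝ → ℝ := fun s => Real.exp ((2 * lo - μ) * s) * E s + D * Real.exp (-(μ * s)) with hΨ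
  have hΨd : ∀ s, HasDerivAt Ψ (Real.exp ((2 * lo - μ) * s) * (2 * lo - μ) * E s +
      Real.exp ((2 * lo - μ) * s) * (∑ i, 2 * w s i * (-(B.mulVec (w s)) - K.mulVec (zH s)) i) +
      D * (Real.exp (-(μ * s)) * (-μ))) s := by
    intro s
    have h1 : HasDerivAt (fun s => Real.exp ((2 * lo - μ) * s)) (Real.exp ((2 * lo - μ) * s) * (2 * lo - μ)) s := by
      have := ((hasDerivAt_id s).const_mul (2 * lo - μ)).exp
      simpa using this
    have h2 : HasDerivAt (fun s => Real.exp (-(μ * s))) (Real.exp (-(μ * s)) * (-μ)) s := by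
      have := (((hasDerivAt_id s).const_mul μ).neg).exp
      simpa using this
    exact (h1.mul (hEd s)).add (h2.const_mul D)
  have hΨ' : ∀ s, 0 < s → Real.exp ((2 * lo - μ) * s) * (2 * lo - μ) * E s +
      Real.exp ((2 * lo - μ) * s) * (∑ i, 2 * w s i * (-(B.mulVec (w s)) - K.mulVec (zH s)) i) +
      D * (Real.exp (-(μ * s)) * (-μ)) ≤ 0 := by
    intro s hs
    have hi1 := hineq μ hμpos s hs.le
    have hpos := Real.exp_pos ((2 * lo - μ) * s)
    have hkey : Real.exp ((2 * lo - μ) * s) * ((τ * hi / 2) ^ 2 * V * Real.exp (-(2 * lo * s)) / μ) =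
        D * (Real.exp (-(μ * s)) * μ) := by
      rw [hD]
      have he : Real.exp ((2 * lo - μ) * s) * Real.exp (-(2 * lo * s)) = Real.exp (-(μ * s)) := by
        rw [← Real.exp_add]; congr 1; ring
      field_simp
      rw [← he]
      ring
    nlinarith [mul_le_mul_of_nonneg_left hi1 hpos.le]
  have hanti : AntitoneOn Ψ (Set.Ici 0) := by
    refine antitoneOn_of_hasDerivWithinAt_nonpos (convex_Ici 0)
      (fun s _ => (hΨd s).continuousAt.continuousWithinAt) (fun s hs => (hΨd s).hasDerivWithinAt) ?_
    intro s hs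
    rw [interior_Ici] at hs
    exact hΨ' s hs
  have hE0 : E 0 = 0 := by simp [hE, hw, hzB, hzH]
  have hΨ0 : Ψ 0 = D := by simp [hΨ, hE0]
  have hΨt : Ψ t ≤ D := by
    rw [← hΨ0]
    exact hanti (Set.mem_Ici.2 le_rfl) (Set.mem_Ici.2 ht) ht
  -- unpack: e^{(2lo-μ)t} E t ≤ D (1 - e^{-μ t}) ≤ D μ t
  have h1e : 1 - Real.exp (-(μ * t)) ≤ μ * t := by
    have := Real.add_one_le_exp (-(μ * t))
    linarith
  have hDnn : 0 ≤ D := by rw [hD]; positivity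
  have hEt : Real.exp ((2 * lo - μ) * t) * E t ≤ D * (μ * t) := by
    have : Real.exp ((2 * lo - μ) * t) * E t ≤ D * (1 - Real.exp (-(μ * t))) := by
      have h := hΨt; simp only [hΨ] at h; linarith
    exact this.trans (mul_le_mul_of_nonneg_left h1e hDnn)
  -- conclude with μ t = 1 and e^{-(2lo-μ)t} = e · e^{-2lo t}
  have hμt : μ * t = 1 := by rw [hμ]; field_simp
  have hexp : Real.exp (-((2 * lo - μ) * t)) = Real.exp 1 * Real.exp (-(2 * lo * t)) := by
    rw [← Real.exp_add]; congr 1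
    have : μ * t = 1 := hμt
    linear_combination this
  have hEt' : E t ≤ Real.exp (-((2 * lo - μ) * t)) * (D * (μ * t)) := by
    have hpos := Real.exp_pos ((2 * lo - μ) * t)
    have h := (le_div_iff₀' hpos).2 hEt
    rw [Real.exp_neg, inv_mul_eq_div]
    exact h
  have hDμ : D * (μ * t) = (τ * hi / 2) ^ 2 * t ^ 2 * V := by
    rw [hD, hμt, mul_one, hμ]
    field_simp
  calc E t ≤ Real.exp (-((2 * lo - μ) * t)) * (D * (μ * t)) := hEt'
    _ = Real.exp 1 * (τ * hi / 2) ^ 2 * t ^ 2 * Real.exp (-(2 * lo * t)) * V := by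
      rw [hexp, hDμ]; ring

/-- **The energy estimate for the Duhamel defect with the sharp first-order constant**:
`Σ wᵢ(t)² ≤ (τhi/2)² t² e^{−2lo t} Σ vᵢ²` (`t ≥ 0`), i.e. `|e^{−tB}v − e^{−tH}v| ≤ (τhi/2)·t·e^{−lo t}|v|`. [folklore] -/
theorem duhamel_defect_sq_le_one {B : Matrix (Fin 3) (Fin 3) ℝ} {τ lo hi : ℝ} (hτ : 0 ≤ τ) (hlo : 0 ≤ lo) (hhi : 0 ≤ hi)
    (hsec : ∀ x z : Fin 3 → ℝ, (x ⬝ᵥ B *ᵥ z - z ⬝ᵥ B *ᵥ x) ^ 2 ≤ τ ^ 2 * ((x ⬝ᵥ B *ᵥ x) * (z ⬝ᵥ B *ᵥ z)))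
    (hwin : ∀ x : Fin 3 → ℝ, lo * (x ⬝ᵥ x) ≤ x ⬝ᵥ B *ᵥ x ∧ x ⬝ᵥ B *ᵥ x ≤ hi * (x ⬝ᵥ x)) (v : Fin 3 → ℝ) {t : ℝ} (ht : 0 ≤ t) :
    ∑ i, ((NormedSpace.exp (-(t • B))).mulVec v - (NormedSpace.exp (-(t • symPart B))).mulVec v) i ^ 2 ≤
      (τ * hi / 2) ^ 2 * t ^ 2 * Real.exp (-(2 * lo * t)) * ∑ i, v i ^ 2 := by
  set H := symPart B with hH
  set K := skewPart B with hK
  set zB : ℝ → Fin 3 → ℝ := fun s => (NormedSpace.exp (-(s • B))).mulVec v with hzB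
  set zH : ℝ → Fin 3 → ℝ := fun s => (NormedSpace.exp (-(s • H))).mulVec v with hzH
  set w : ℝ → Fin 3 → ℝ := fun s => zB s - zH s with hw
  set V := ∑ i, v i ^ 2 with hV
  set E : ℝ → ℝ := fun s => ∑ i, w s i ^ 2 with hE
  have hV0 : 0 ≤ V := Finset.sum_nonneg fun i _ => sq_nonneg _
  have hE0' : ∀ s, 0 ≤ E s := fun s => Finset.sum_nonneg fun i _ => sq_nonneg _
  set a := τ * hi / 2 * Real.sqrt V with ha
  have ha0 : 0 ≤ a := by rw [ha]; positivity
  -- derivative of w and of the energy (as in `duhamel_defect_sq_le`)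
  have hwd : ∀ s, HasDerivAt w (-(B.mulVec (zB s)) - -(H.mulVec (zH s))) s := fun s =>
    (hasDerivAt_exp_neg_smul_mulVec B v s).sub (hasDerivAt_exp_neg_smul_mulVec H v s)
  have hderiv_eq : ∀ s, -(B.mulVec (zB s)) - -(H.mulVec (zH s)) = -(B.mulVec (w s)) - K.mulVec (zH s) := by
    intro s
    have h1 : zB s = w s + zH s := by simp [hw]
    have h2 : K = B - H := eq_sub_of_add_eq' (symPart_add_skewPart B)
    rw [h1, Matrix.mulVec_add, h2, Matrix.sub_mulVec]
    abel
  have hEd : ∀ s, HasDerivAt E (∑ i, 2 * w s i * (-(B.mulVec (w s)) - K.mulVec (zH s)) i) s := by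
    intro s
    have h := (hwd s)
    rw [hderiv_eq s, hasDerivAt_pi] at h
    have h2 := HasDerivAt.fun_sum (u := Finset.univ) fun i _ => (h i).fun_pow 2
    refine h2.congr_deriv (Finset.sum_congr rfl fun i _ => ?_)
    simp only [Nat.cast_ofNat, Nat.add_one_sub_one, pow_one]
  -- the SHARP differential inequality: E' ≤ -2 lo E + 2 √E · a e^{-lo s}   (s ≥ 0)
  have hineq : ∀ s : ℝ, 0 ≤ s →
      ∑ i, 2 * w s i * (-(B.mulVec (w s)) - K.mulVec (zH s)) i ≤
        -2 * lo * E s + 2 * Real.sqrt (E s) * (a * Real.exp (-(lo * s))) := by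
    intro s hs
    have hsplit : ∑ i, 2 * w s i * (-(B.mulVec (w s)) - K.mulVec (zH s)) i =
        -2 * (w s ⬝ᵥ B *ᵥ w s) + 2 * ∑ i, (-w s i) * K.mulVec (zH s) i := by
      simp only [dotProduct, Pi.sub_apply, Pi.neg_apply, Finset.mul_sum, ← Finset.sum_add_distrib]
      refine Finset.sum_congr rfl fun i _ => ?_
      ring
    rw [hsplit]
    have hBw : lo * E s ≤ w s ⬝ᵥ B *ᵥ w s := by
      have := (hwin (w s)).1
      rw [self_dotProduct_eq_sum_sq] at this
      exact this
    have hCS : ∑ i, (-w s i) * K.mulVec (zH s) i ≤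
        Real.sqrt (∑ i, (-w s i) ^ 2) * Real.sqrt (∑ i, K.mulVec (zH s) i ^ 2) :=
      Real.sum_mul_le_sqrt_mul_sqrt Finset.univ (fun i => -w s i) (fun i => K.mulVec (zH s) i)
    have hneg : ∑ i, (-w s i) ^ 2 = E s := by
      simp only [hE, neg_sq]
    rw [hneg] at hCS
    have hKz : ∑ i, K.mulVec (zH s) i ^ 2 ≤ (τ * hi / 2) ^ 2 * ∑ i, zH s i ^ 2 := skewPart_sq_le hlo hsec hwin (zH s)
    have hzH : ∑ i, zH s i ^ 2 ≤ Real.exp (-(2 * lo * s)) * V :=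
      sum_sq_exp_neg_smul_mulVec_le H (fun x => (window_symPart_sum hwin x).1) v hs
    have hsq : Real.sqrt (∑ i, K.mulVec (zH s) i ^ 2) ≤ a * Real.exp (-(lo * s)) := by
      rw [Real.sqrt_le_left (by positivity)]
      have he2 : Real.exp (-(lo * s)) ^ 2 = Real.exp (-(2 * lo * s)) := by
        rw [sq, ← Real.exp_add]; congr 1; ring
      calc ∑ i, K.mulVec (zH s) i ^ 2 ≤ (τ * hi / 2) ^ 2 * (Real.exp (-(2 * lo * s)) * V) :=
            hKz.trans (mul_le_mul_of_nonneg_left hzH (sq_nonneg _))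
        _ = (a * Real.exp (-(lo * s))) ^ 2 := by
            rw [ha, mul_pow, mul_pow, Real.sq_sqrt hV0, he2]; ring
    have hsE : 0 ≤ Real.sqrt (E s) := Real.sqrt_nonneg _
    nlinarith [mul_le_mul_of_nonneg_left hsq hsE]
  -- the regularised Lyapunov function, for ε > 0
  have main : ∀ ε : ℝ, 0 < ε → Real.exp (lo * t) * Real.sqrt (E t) ≤ a * t + ε * Real.exp (lo * t) := by
    intro ε hε
    set Φ : ℝ → ℝ := fun s => Real.exp (lo * s) * Real.sqrt (E s + ε ^ 2) - a * s - ε * Real.exp (lo * s) with hΦ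
    have hRpos : ∀ s, 0 < E s + ε ^ 2 := fun s => by positivity
    have hΦd : ∀ s, HasDerivAt Φ (Real.exp (lo * s) * lo * Real.sqrt (E s + ε ^ 2) +
        Real.exp (lo * s) * ((∑ i, 2 * w s i * (-(B.mulVec (w s)) - K.mulVec (zH s)) i) / (2 * Real.sqrt (E s + ε ^ 2))) -
        a - ε * (Real.exp (lo * s) * lo)) s := by
      intro s
      have h1 : HasDerivAt (fun s => Real.exp (lo * s)) (Real.exp (lo * s) * lo) s := by
        have := ((hasDerivAt_id s).const_mul lo).exp
        simpa using this
      have h2 : HasDerivAt (fun s => Real.sqrt (E s + ε ^ 2))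
          ((∑ i, 2 * w s i * (-(B.mulVec (w s)) - K.mulVec (zH s)) i) / (2 * Real.sqrt (E s + ε ^ 2))) s := by
        have := ((hEd s).add_const (ε ^ 2)).sqrt (hRpos s).ne'
        simpa using this
      have h3 : HasDerivAt (fun s => a * s) a s := by simpa using (hasDerivAt_id s).const_mul a
      exact ((h1.mul h2).sub h3).sub (h1.const_mul ε)
    have hΦ' : ∀ s, 0 < s → Real.exp (lo * s) * lo * Real.sqrt (E s + ε ^ 2) +
        Real.exp (lo * s) * ((∑ i, 2 * w s i * (-(B.mulVec (w s)) - K.mulVec (zH s)) i) / (2 * Real.sqrt (E s + ε ^ 2))) -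
        a - ε * (Real.exp (lo * s) * lo) ≤ 0 := by
      intro s hs
      set R := Real.sqrt (E s + ε ^ 2) with hR
      set D := ∑ i, 2 * w s i * (-(B.mulVec (w s)) - K.mulVec (zH s)) i with hDdef
      have hR0 : 0 < R := Real.sqrt_pos.2 (hRpos s)
      have hR2 : R ^ 2 = E s + ε ^ 2 := Real.sq_sqrt (hRpos s).le
      have hEs := hE0' s
      have hsqE : Real.sqrt (E s) ≤ R := Real.sqrt_le_sqrt (by nlinarith)
      have hsqE0 : 0 ≤ Real.sqrt (E s) := Real.sqrt_nonneg _
      have hsqE2 : Real.sqrt (E s) ^ 2 = E s := Real.sq_sqrt hEs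
      have hεR : ε ≤ R := by
        have : Real.sqrt (ε ^ 2) ≤ R := Real.sqrt_le_sqrt (by nlinarith)
        rwa [Real.sqrt_sq hε.le] at this
      have hexp := Real.exp_pos (lo * s)
      have hee : Real.exp (lo * s) * Real.exp (-(lo * s)) = 1 := by rw [← Real.exp_add, add_neg_cancel, Real.exp_zero]
      set b := a * Real.exp (-(lo * s)) with hb
      have hb0 : 0 ≤ b := by rw [hb]; positivity
      have hDle : D ≤ -2 * lo * E s + 2 * Real.sqrt (E s) * b := hineq s hs.le
      -- the bracket: lo R + D/(2R) - ε lo ≤ b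
      have hbr : lo * R + D / (2 * R) - ε * lo ≤ b := by
        have h2R : 0 < 2 * R := by positivity
        have hdiv : D / (2 * R) ≤ (-2 * lo * E s + 2 * Real.sqrt (E s) * b) / (2 * R) :=
          div_le_div_of_nonneg_right hDle h2R.le
        have hkey : lo * R + (-2 * lo * E s + 2 * Real.sqrt (E s) * b) / (2 * R) - ε * lo ≤ b := by
          rw [← sub_nonpos]
          have : lo * R + (-2 * lo * E s + 2 * Real.sqrt (E s) * b) / (2 * R) - ε * lo - b =
              (lo * ε * (ε - R) + (b * (Real.sqrt (E s) - R))) / R := by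
            field_simp
            nlinarith [hR2]
          rw [this]
          refine div_nonpos_of_nonpos_of_nonneg ?_ hR0.le
          nlinarith [mul_nonneg hlo hε.le, hb0]
        linarith
      have hab : Real.exp (lo * s) * b = a := by
        rw [hb, ← mul_assoc, mul_comm (Real.exp (lo * s)) a, mul_assoc, hee, mul_one]
      nlinarith [mul_le_mul_of_nonneg_left hbr hexp.le]
    have hanti : AntitoneOn Φ (Set.Ici 0) := by
      refine antitoneOn_of_hasDerivWithinAt_nonpos (convex_Ici 0)
        (fun s _ => (hΦd s).continuousAt.continuousWithinAt) (fun s hs => (hΦd s).hasDerivWithinAt) ?_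
      intro s hs
      rw [interior_Ici] at hs
      exact hΦ' s hs
    have hE0 : E 0 = 0 := by simp [hE, hw, hzB, hzH]
    have hΦ0 : Φ 0 = 0 := by
      simp only [hΦ, hE0, mul_zero, Real.exp_zero, one_mul, zero_add, sub_zero, mul_one]
      rw [Real.sqrt_sq hε.le, sub_self]
    have hΦt : Φ t ≤ 0 := by
      rw [← hΦ0]
      exact hanti (Set.mem_Ici.2 le_rfl) (Set.mem_Ici.2 ht) ht
    have hmono : Real.sqrt (E t) ≤ Real.sqrt (E t + ε ^ 2) := Real.sqrt_le_sqrt (by nlinarith)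
    have hexp := Real.exp_pos (lo * t)
    have h1 : Real.exp (lo * t) * Real.sqrt (E t + ε ^ 2) ≤ a * t + ε * Real.exp (lo * t) := by
      simp only [hΦ] at hΦt; linarith
    exact (mul_le_mul_of_nonneg_left hmono hexp.le).trans h1
  -- ε → 0
  have hlim : Real.exp (lo * t) * Real.sqrt (E t) ≤ a * t := by
    refine le_of_forall_pos_le_add fun ε hε => ?_
    have hexp := Real.exp_pos (lo * t)
    have h := main (ε / Real.exp (lo * t)) (div_pos hε hexp)
    rwa [div_mul_cancel₀ _ hexp.ne'] at h
  -- square it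
  have hexp := Real.exp_pos (lo * t)
  have hsq0 : 0 ≤ Real.exp (lo * t) * Real.sqrt (E t) := by positivity
  have h2 : (Real.exp (lo * t) * Real.sqrt (E t)) ^ 2 ≤ (a * t) ^ 2 := pow_le_pow_left₀ hsq0 hlim 2
  rw [mul_pow, Real.sq_sqrt (hE0' t)] at h2
  have he2 : Real.exp (lo * t) ^ 2 * Real.exp (-(2 * lo * t)) = 1 := by
    rw [sq, ← Real.exp_add, ← Real.exp_add, show lo * t + lo * t + -(2 * lo * t) = 0 by ring, Real.exp_zero]
  have ha2 : a ^ 2 = (τ * hi / 2) ^ 2 * V := by rw [ha, mul_pow, Real.sq_sqrt hV0]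
  have hpos2 := Real.exp_pos (-(2 * lo * t))
  calc E t = Real.exp (lo * t) ^ 2 * E t * Real.exp (-(2 * lo * t)) := by
        rw [mul_comm (Real.exp (lo * t) ^ 2), mul_assoc, he2, mul_one]
    _ ≤ (a * t) ^ 2 * Real.exp (-(2 * lo * t)) := mul_le_mul_of_nonneg_right h2 hpos2.le
    _ = (τ * hi / 2) ^ 2 * t ^ 2 * Real.exp (-(2 * lo * t)) * V := by rw [mul_pow, ha2]; ring

end Duhamel

end Summit.AnomalousDissipation.AnomalousDissipation.Theorems.SolenoidalFractalHomogenisation.LagrangianStep.OddGain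

end
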